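import Mathlib
import Summits.MatrixMultiplication.MatrixMultiplication.Theorems.HiddenToeplitzCornersHiddenCornerLemmaRStein

/-!
# Hidden-corner lemma, column-type rank-one displacement (`d = 1`, G-constant class)

Support file for crux item `stmt-MatrixMultiplication-10752`
(`Summit.MatrixMultiplication.MatrixMultiplication.Theses.HiddenToeplitzCorners.HiddenCornerLemmaR`).

If every coefficient matrix of the pencil has Stein displacement `T a b − Z (T a b) Zᵀ = u ⊗ v a b`
with a COMMON left factor `u` (column type), the pencil hides a linearly explained corner
`T(X) E = F X` with `E`, `F` of rank `r`, and some `T(X₀)` is nonsingular, then `r ≤ 1`.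

Proof (valuation argument). Stein inversion gives `T a b = L(u) L(v a b)ᵀ` with `L(w)` the
lower-triangular Toeplitz matrix `(L w) i k = w (i − k)` (`k ≤ i`); nonsingularity forces `u 0 ≠ 0`,
so `L(u)` is injective and the corner relation becomes `corr (v a b) (E·c) = 0` for `c ≠ b` and
`≠ 0` for `c = b` (for an `a` with `F·a ≠ 0`), where `corr h e k = Σ_{i ≥ k} h (i − k) e i`.
For nonzero `h`, `e` with valuation `ν(h)` and degree `δ(e)`: `corr h e = 0 → δ(e) < ν(h)` and
`corr h e ≠ 0 → ν(h) ≤ δ(e)`; two frame columns then give `δ₂ < ν₁ ≤ δ₁ < ν₂ ≤ δ₂`, absurd.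
-/

set_option linter.dupNamespace false

namespace Summit.MatrixMultiplication.MatrixMultiplication.Theorems

open Matrix BigOperators Finset

/-- **Column-type `d = 1` case of the hidden-corner lemma (G-constant class).**
If `T a b − Z (T a b) Zᵀ = u ⊗ v a b` for a common `u`, the pencil hides a linearly explained corner
with frames of rank `r`, and some value of the pencil is nonsingular, then `r ≤ 1`. -/
theorem hclR_gconst_d_one (r N : ℕ) (T : Fin r → Fin r → Matrix (Fin N) (Fin N) ℂ)
    (E F : Matrix (Fin N) (Fin r) ℂ) (hE : E.rank = r) (hF : F.rank = r)
    (u : Fin N → ℂ) (v : Fin r → Fin r → Fin N → ℂ)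
    (hdisp : ∀ a b, T a b - (Matrix.of fun i j : Fin N => if (i : ℕ) = (j : ℕ) + 1 then (1 : ℂ) else 0) * T a b *
        (Matrix.of fun i j : Fin N => if (i : ℕ) = (j : ℕ) + 1 then (1 : ℂ) else 0)ᵀ = Matrix.vecMulVec u (v a b))
    (hcorner : ∀ X : Matrix (Fin r) (Fin r) ℂ, (∑ a : Fin r, ∑ b : Fin r, X a b • T a b) * E = F * X)
    (hns : ∃ X₀ : Matrix (Fin r) (Fin r) ℂ, (∑ a : Fin r, ∑ b : Fin r, X₀ a b • T a b).det ≠ 0) :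
    r ≤ 1 := by
  by_contra hr
  push Not at hr
  set Z := (Matrix.of fun i j : Fin N => if (i : ℕ) = (j : ℕ) + 1 then (1 : ℂ) else 0) with hZ
  -- N ≥ 1 (else E has rank 0)
  have hN : 0 < N := by
    rcases Nat.eq_zero_or_pos N with h | h
    · subst h
      have : E.rank ≤ 0 := by
        simpa using Matrix.rank_le_card_height E
      omega
    · exact h
  -- each T a b is the Stein sum
  have hT : ∀ a b, T a b = ∑ k ∈ Finset.range N, Z ^ k * Matrix.vecMulVec u (v a b) * (Zᵀ) ^ k :=
    fun a b => hclR_eq_stein_sum (T a b) u (v a b) (hdisp a b)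
  -- u 0 ≠ 0 from nonsingularity
  have hu : u ⟨0, hN⟩ ≠ 0 := by
    intro hu0
    obtain ⟨X₀, hX₀⟩ := hns
    apply hX₀
    apply Matrix.det_eq_zero_of_row_eq_zero ⟨0, hN⟩
    intro j
    rw [Matrix.sum_apply]
    apply Finset.sum_eq_zero; intro a _
    rw [Matrix.sum_apply]
    apply Finset.sum_eq_zero; intro b _
    rw [Matrix.smul_apply, hT a b, hclR_stein_sum_row_zero u (v a b) hN j, hu0]; simp
  -- corner, column by column
  have hcol : ∀ a b c : Fin r, T a b *ᵥ (fun i => E i c) = if c = b then (fun i => F i a) else 0 := by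
    intro a b c
    have h1 := hcorner (Matrix.single a b 1)
    have hsum : (∑ a' : Fin r, ∑ b' : Fin r, (Matrix.single a b (1 : ℂ)) a' b' • T a' b') = T a b := by
      rw [Finset.sum_eq_single a]
      · rw [Finset.sum_eq_single b]
        · simp
        · intro b' _ hb'; simp [hb'.symm]
        · simp
      · intro a' _ ha'
        apply Finset.sum_eq_zero; intro b' _
        simp [ha'.symm]
      · simp
    rw [hsum] at h1
    ext i
    have h2 := congr_fun (congr_fun h1 i) c
    rw [Matrix.mul_apply] at h2
    simp only [Matrix.mulVec, dotProduct]
    rw [h2, Matrix.mul_apply]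
    by_cases hcb : c = b
    · subst hcb
      rw [if_pos rfl, Finset.sum_eq_single a]
      · simp
      · intro j _ hj; simp [hj.symm]
      · simp
    · rw [if_neg hcb]
      simp only [Pi.zero_apply]
      apply Finset.sum_eq_zero; intro j _
      simp only [Matrix.single_apply, mul_ite, mul_one, mul_zero, ite_eq_right_iff, and_imp]
      intro _ hbc; exact absurd hbc.symm hcb
  -- the two frame indices
  set b₁ : Fin r := ⟨0, by omega⟩ with hb₁
  set b₂ : Fin r := ⟨1, by omega⟩ with hb₂
  have hb12 : b₁ ≠ b₂ := by simp [hb₁, hb₂, Fin.ext_iff]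
  -- some column of F is nonzero
  have hFne : ∃ a : Fin r, (fun i => F i a) ≠ 0 := by
    by_contra hall
    push Not at hall
    have : F = 0 := by
      ext i a; exact congr_fun (hall a) i
    rw [this, Matrix.rank_zero] at hF; omega
  obtain ⟨a, ha⟩ := hFne
  -- every column of E is nonzero
  have hEcol : ∀ c : Fin r, (fun i => E i c) ≠ 0 := by
    intro c hc
    have hker : (Pi.single c (1 : ℂ) : Fin r → ℂ) ∈ LinearMap.ker E.mulVecLin := by
      rw [LinearMap.mem_ker, Matrix.mulVecLin_apply]
      ext i
      simp only [Matrix.mulVec, dotProduct, Pi.single_apply, mul_ite, mul_one, mul_zero,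
        Finset.sum_ite_eq', Finset.mem_univ, if_true, Pi.zero_apply]
      exact congr_fun hc i
    have hk : 0 < Module.finrank ℂ (LinearMap.ker E.mulVecLin) := by
      apply Module.finrank_pos_iff_exists_ne_zero.mpr
      refine ⟨⟨Pi.single c 1, hker⟩, ?_⟩
      simp [Subtype.ext_iff]
    have hrn := LinearMap.finrank_range_add_finrank_ker E.mulVecLin
    have hrk : E.rank = Module.finrank ℂ (LinearMap.range E.mulVecLin) := rfl
    simp only [Module.finrank_fintype_fun_eq_card, Fintype.card_fin] at hrn
    omega
  -- correlation data of v a b against the frame columns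
  have hcorr : ∀ b c : Fin r, (∑ k ∈ Finset.range N,
      (∑ m : Fin N, v a b m * (if h : (m : ℕ) + k < N then E ⟨(m : ℕ) + k, h⟩ c else 0)) • (Z ^ k *ᵥ u)) =
      if c = b then (fun i => F i a) else 0 := by
    intro b c
    rw [← hcol a b c, hT a b, hZ, hclR_stein_sum_mulVec]
    refine Finset.sum_congr rfl fun k _ => ?_
    rw [hclR_dot_shiftT_pow]
  -- valuations ν b (least index of a nonzero entry of v a b) and degrees δ c of the frame columns
  have hvne : ∀ b : Fin r, ∃ m : Fin N, v a b m ≠ 0 := by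
    intro b
    by_contra hall; push Not at hall
    have := hcorr b b
    rw [if_pos rfl] at this
    apply ha
    rw [← this]
    apply Finset.sum_eq_zero; intro k _
    have : (∑ m : Fin N, v a b m * (if h : (m : ℕ) + k < N then E ⟨(m : ℕ) + k, h⟩ b else 0)) = 0 := by
      apply Finset.sum_eq_zero; intro m _; simp [hall m]
    rw [this, zero_smul]
  have key : ∀ b c : Fin r, ∀ ν δ : Fin N, v a b ν ≠ 0 → (∀ m, v a b m ≠ 0 → (ν : ℕ) ≤ m) →
      E δ c ≠ 0 → (∀ i, E i c ≠ 0 → (i : ℕ) ≤ δ) →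
      (c ≠ b → (δ : ℕ) < ν) ∧ (c = b → (ν : ℕ) ≤ δ) := by
    intro b c ν δ hvν hvmin hEδ hEmax
    constructor
    · intro hcb
      by_contra hle; push Not at hle
      have hz := hcorr b c
      rw [if_neg hcb] at hz
      have hall := hclR_coeff_eq_zero_of_sum_smul_shift u _ hN hu hz ((δ : ℕ) - ν) (by have := δ.2; omega)
      exact hclR_corr_ne_zero_at (v a b) (fun i => E i c) ν δ hvν hvmin hEδ hEmax hle hall
    · intro hcb
      subst hcb
      by_contra hlt; push Not at hlt
      have hz := hcorr c c
      rw [if_pos rfl] at hz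
      apply ha; rw [← hz]
      apply Finset.sum_eq_zero; intro k _
      rw [hclR_corr_eq_zero_of_lt (v a c) (fun i => E i c) ν δ hvmin hEmax hlt k, zero_smul]
  -- extract extremal indices
  have hmin : ∀ b : Fin r, ∃ ν : Fin N, v a b ν ≠ 0 ∧ ∀ m, v a b m ≠ 0 → (ν : ℕ) ≤ m := by
    intro b
    obtain ⟨m0, hm0⟩ := hvne b
    obtain ⟨ν, hν, hmin⟩ := (Finset.univ.filter fun m : Fin N => v a b m ≠ 0).exists_min_image
      (fun m => (m : ℕ)) ⟨m0, by simp [hm0]⟩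
    exact ⟨ν, (Finset.mem_filter.mp hν).2, fun m hm => hmin m (by simp [hm])⟩
  have hmax : ∀ c : Fin r, ∃ δ : Fin N, E δ c ≠ 0 ∧ ∀ i, E i c ≠ 0 → (i : ℕ) ≤ δ := by
    intro c
    have : ∃ i0 : Fin N, E i0 c ≠ 0 := by
      by_contra hall; push Not at hall
      exact hEcol c (funext hall)
    obtain ⟨i0, hi0⟩ := this
    obtain ⟨δ, hδ, hmax⟩ := (Finset.univ.filter fun i : Fin N => E i c ≠ 0).exists_max_image
      (fun i => (i : ℕ)) ⟨i0, by simp [hi0]⟩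
    exact ⟨δ, (Finset.mem_filter.mp hδ).2, fun i hi => hmax i (by simp [hi])⟩
  obtain ⟨ν₁, hν₁, hν₁min⟩ := hmin b₁
  obtain ⟨ν₂, hν₂, hν₂min⟩ := hmin b₂
  obtain ⟨δ₁, hδ₁, hδ₁max⟩ := hmax b₁
  obtain ⟨δ₂, hδ₂, hδ₂max⟩ := hmax b₂
  have h11 := (key b₁ b₁ ν₁ δ₁ hν₁ hν₁min hδ₁ hδ₁max).2 rfl
  have h12 := (key b₁ b₂ ν₁ δ₂ hν₁ hν₁min hδ₂ hδ₂max).1 hb12.symm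
  have h22 := (key b₂ b₂ ν₂ δ₂ hν₂ hν₂min hδ₂ hδ₂max).2 rfl
  have h21 := (key b₂ b₁ ν₂ δ₁ hν₂ hν₂min hδ₁ hδ₁max).1 hb12
  omega

end Summit.MatrixMultiplication.MatrixMultiplication.Theorems
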